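import Summits.PneNP.PneNP.Theorems.Sd2BlMachineDictPieces
import Summits.PneNP.PneNP.Theorems.SfmBlMachineDictGraph

/-!
# K1'' machine side (S3), DICTIONARY D1b (generic): the pipeline's leg graph is the machine's piece graph

Cell pnp-ideate, ROUND-18 item K1''; twin of `SfmBlMachineDictGraph` with `trips ↦ raw` (generic in the raw-leg list
of `Sd2BlMachineLegs`; legs = positions, pieces = labels, D1 `Sd2BlMachineDictPieces`).  `Sd2Bl.legBound_of_pipeline`
states sparseness (`hsp`) for pairs `(W₁, W₂)` of pieces CONNECTED in `bipGraph (fun i k => ∃ e, src e = i ∧ dst e = k)`;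
for the piece structure `srcG / dstG` this graph is, through `Subtype.val`, the machine's `pieceGraph` on the labels
of `pieceLegsG L raw` (`pieceGraphG_adj_iff_exists_leg`), whence `connected_pipelineG_iff_connected_labels` (via
`SfmBl.isConnectedPair_iff_connected_labels`) with the size bookkeeping `card_labelsOfG`, `labelsOfG_subset_pieces`.
The tag lemmas (`labL_tag`, `tag_ne_of_mem_nbrs`, `not_pieceGraph_adj_of_tag_eq`) are the CAND file's, by name.
Restricted-model algorithmic infrastructure; nothing here bears on `P` versus `NP`.
-/

set_option linter.dupNamespace false -- `Summit.PneNP.PneNP.…`: summit = sub-problem name (D-0017 single-conjunct layout)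

namespace Summit.PneNP.PneNP.Theorems.Sd2BlMachine

open Literature.Computability.Complexity
open Summit.PneNP.PneNP.Theorems.SfmBlMachine (Lab PLeg labL labR nbrs pieces pieceGraph pieceGraph_adj labL_tag labR_tag
  not_pieceGraph_adj_of_tag_eq)
open Summit.PneNP.PneNP.Theorems.SfmBl (bipGraph IsConnectedPair)

variable (L : ℕ) (raw : List RLeg)

/-! ## Tags -/

/-- A left piece label has tag `0`. -/
theorem LPieceG.tag (P : LPieceG L raw) : P.1.1 = 0 := by
  obtain ⟨x, _, hx⟩ := List.mem_map.1 P.2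
  rw [← hx]; rfl

/-- A right piece label has tag `1`. -/
theorem RPieceG.tag (Q : RPieceG L raw) : Q.1.1 = 1 := by
  obtain ⟨x, _, hx⟩ := List.mem_map.1 Q.2
  rw [← hx]; rfl

/-- Left and right piece labels differ. -/
theorem LPieceG.val_ne (P : LPieceG L raw) (Q : RPieceG L raw) : P.1 ≠ Q.1 := by
  intro h
  have h1 := LPieceG.tag L raw P
  rw [h, RPieceG.tag L raw Q] at h1
  exact absurd h1 (by decide)

/-- Every pieced leg is the pieced leg of a position. -/
theorem exists_eq_plegOfG {x : PLeg} (hx : x ∈ pieceLegsG L raw) : ∃ i : Fin raw.length, plegOfG L raw i = x := by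
  obtain ⟨i, hi, rfl⟩ := (mem_pieceLegsG_iff L raw x).1 hx
  exact ⟨⟨i, hi⟩, rfl⟩

/-! ## Adjacency -/

/-- ADJACENCY DICTIONARY: a left piece and a right piece are adjacent in the machine's piece graph iff some leg
(position) joins them. -/
theorem pieceGraphG_adj_iff_exists_leg (i : LPieceG L raw) (k : RPieceG L raw) :
    (pieceGraph (pieceLegsG L raw)).Adj i.1 k.1 ↔ ∃ e, srcG L raw e = i ∧ dstG L raw e = k := by
  rw [pieceGraph_adj]
  constructor
  · rintro ⟨_, hk⟩
    unfold nbrs at hk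
    rw [List.mem_append, List.mem_map, List.mem_map] at hk
    rcases hk with ⟨x, hx, hxk⟩ | ⟨x, hx, hxk⟩
    · rw [List.mem_filter, decide_eq_true_eq] at hx
      obtain ⟨e, rfl⟩ := exists_eq_plegOfG L raw hx.1
      exact ⟨e, Subtype.ext hx.2, Subtype.ext hxk⟩
    · have : (labL x).1 = k.1.1 := by rw [hxk]
      rw [RPieceG.tag L raw k, labL_tag] at this
      exact absurd this (by decide)
  · rintro ⟨e, rfl, rfl⟩
    refine ⟨LPieceG.val_ne L raw _ _, ?_⟩
    unfold nbrs
    rw [List.mem_append]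
    left
    exact List.mem_map.2 ⟨plegOfG L raw e, List.mem_filter.2 ⟨plegOfG_mem L raw e, by rw [decide_eq_true_eq]; rfl⟩, rfl⟩

/-! ## Connectivity of a pipeline pair = connectivity of its label set -/

variable {L raw}

/-- The label set of a pair of piece sets. -/
def labelsOfG (W₁ : Finset (LPieceG L raw)) (W₂ : Finset (RPieceG L raw)) : Finset Lab :=
  W₁.image Subtype.val ∪ W₂.image Subtype.val

/-- The label set has `|W₁| + |W₂|` elements. -/
theorem card_labelsOfG (W₁ : Finset (LPieceG L raw)) (W₂ : Finset (RPieceG L raw)) :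
    (labelsOfG W₁ W₂).card = W₁.card + W₂.card :=
  SfmBl.card_image_union_image Subtype.val Subtype.val W₁ W₂ (Subtype.val_injective.injOn)
    (Subtype.val_injective.injOn) (fun i _ k _ => LPieceG.val_ne L raw i k)

/-- Every label of the label set is a piece of the machine. -/
theorem labelsOfG_subset_pieces (W₁ : Finset (LPieceG L raw)) (W₂ : Finset (RPieceG L raw)) :
    ∀ P ∈ labelsOfG W₁ W₂, P ∈ pieces (pieceLegsG L raw) := by
  intro P hP
  unfold labelsOfG at hP
  unfold pieces
  rw [List.mem_dedup, List.mem_append]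
  rcases Finset.mem_union.1 hP with h | h
  · obtain ⟨i, _, rfl⟩ := Finset.mem_image.1 h
    exact Or.inl i.2
  · obtain ⟨k, _, rfl⟩ := Finset.mem_image.1 h
    exact Or.inr k.2

/-- The left labels of the label set are those of `W₁`. -/
theorem mem_labelsOfG_left (W₁ : Finset (LPieceG L raw)) (W₂ : Finset (RPieceG L raw)) (i : LPieceG L raw) :
    i.1 ∈ labelsOfG W₁ W₂ ↔ i ∈ W₁ := by
  unfold labelsOfG
  rw [Finset.mem_union, Finset.mem_image, Finset.mem_image]
  constructor
  · rintro (⟨i', hi', h⟩ | ⟨k, _, h⟩)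
    · rwa [← Subtype.ext h]
    · exact absurd h.symm (LPieceG.val_ne L raw i k)
  · intro h; exact Or.inl ⟨i, h, rfl⟩

/-- The right labels of the label set are those of `W₂`. -/
theorem mem_labelsOfG_right (W₁ : Finset (LPieceG L raw)) (W₂ : Finset (RPieceG L raw)) (k : RPieceG L raw) :
    k.1 ∈ labelsOfG W₁ W₂ ↔ k ∈ W₂ := by
  unfold labelsOfG
  rw [Finset.mem_union, Finset.mem_image, Finset.mem_image]
  constructor
  · rintro (⟨i, _, h⟩ | ⟨k', hk', h⟩)
    · exact absurd h (LPieceG.val_ne L raw i k)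
    · rwa [← Subtype.ext h]
  · intro h; exact Or.inr ⟨k, h, rfl⟩

/-- **CONNECTIVITY DICTIONARY**: a pair `(W₁, W₂)` of pieces is connected for the pipeline's leg relation (the
`Sum.elim` spelling of `hsp`) iff its label set is connected in the machine's piece graph. -/
theorem connected_pipelineG_iff_connected_labels (W₁ : Finset (LPieceG L raw)) (W₂ : Finset (RPieceG L raw)) :
    ((bipGraph (fun i k => ∃ e, srcG L raw e = i ∧ dstG L raw e = k)).induce
        {x | Sum.elim (fun i => i ∈ W₁) (fun k => k ∈ W₂) x}).Connected
      ↔ ((pieceGraph (pieceLegsG L raw)).induce (labelsOfG W₁ W₂ : Set Lab)).Connected := by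
  rw [← SfmBl.isConnectedPair_iff_sumElim]
  unfold labelsOfG
  exact SfmBl.isConnectedPair_iff_connected_labels _ (pieceGraph (pieceLegsG L raw)) Subtype.val Subtype.val
    W₁ W₂ (Subtype.val_injective.injOn) (Subtype.val_injective.injOn) (fun i _ k _ => LPieceG.val_ne L raw i k)
    (fun i _ i' _ => not_pieceGraph_adj_of_tag_eq _ (by rw [LPieceG.tag L raw i, LPieceG.tag L raw i']))
    (fun k _ k' _ => not_pieceGraph_adj_of_tag_eq _ (by rw [RPieceG.tag L raw k, RPieceG.tag L raw k']))
    (fun i _ k _ => (pieceGraphG_adj_iff_exists_leg L raw i k).symm)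

end Summit.PneNP.PneNP.Theorems.Sd2BlMachine
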